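import Literature.Topology.FourManifolds.LefschetzBaseCover
import Literature.Topology.FourManifolds.LefschetzBaseCoverSectors
import HarnessLib

/-!
# The standard Lefschetz base of genus `g`, XI: the Milnor cover of the base page `w = 1/2`

Topic `Literature/Topology/FourManifolds`; namespace `Literature.Topology.FourManifolds.LefschetzBase`.
The base page `page g 1 = {‖x‖² < 4, w = 1/2} ⊂ ∂ Base g` (`LefschetzBasePages.lean`) is the part
over `‖x‖ < 2` of the smooth fibre `y² = x^{2g+1} + 3/2` — a copy of the open Milnor fibre `F_{g,1}`.
Towards **`Hₖ(page g 1) ≅ Hₖ(Base g)` by the inclusion** (on paper `Base g ≅ F × D²` fibred by the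
pages; Milnor 1968, Thm. 9.1 / Lemma 9.4) we run the Milnor cover `Base g = U ∪ V` of
`LefschetzBaseCover*.lean` (`U = {Re x^{2g+1} > −3/8}`, `V = {Re x^{2g+1} < −1/4}`) INSIDE the page:
the traces `pageU g = U ∩ page`, `pageV g = V ∩ page` deformation retract, inside the page, onto
finitely many points through the SAME index maps (sheet sign `idxU`, sector root `idxV`) as the
pieces of the base — so that the inclusions `pageU g ↪ U`, `pageV g ↪ V` are homotopy equivalences
over `Fin 2`, `Fin (2g+1)` (the overlap is treated in `LefschetzBasePageCoverOverlap.lean`, the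
Mayer–Vietoris comparison downstream).  Everything here is PROVED; nothing is asserted.

* §13 bookkeeping on the page: `cy_sq_of_mem_page` (`y² = x^{2g+1} + 3/2`), `mk_mem_base_of_page` /
  `mk_mem_page` (a point with `b'² − a'^{2g+1} − 1 = 1/2`, `‖a'‖^{2g+1} < 2^{2g+1}` lies in the base
  page), the pieces `pageU`, `pageV` and the restrictions `resPU : pageU g → U`, `resPV : pageV g → V`;
* §14 `(x, y) ↦ (t x, angU · √((tx)^{2g+1} + 3/2))` retracts `pageU g` onto `(0, ±√(3/2))`:
  **`homotopyPU : id ≃ secPU ∘ idxU ∘ resPU`**, `idxU_secPU : idxU ∘ resPU ∘ secPU = id`;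
* §15 `(x, y) ↦ (angV · ν (3/2 − t²(x^{2g+1} + 3/2))^{1/(2g+1)}, t y)` retracts `pageV g` onto the
  `2g+1` branch points `(ν μ^k (3/2)^{1/(2g+1)}, 0)` of the page: **`homotopyPV`**, `idxV_secPV`.

## References
* J. Milnor, *Singular points of complex hypersurfaces*, Ann. of Math. Studies 61 (1968), §9,
  Thm. 9.1, Lemma 9.2, Lemma 9.4. [Milnor1968]
-/
noncomputable section

open scoped Manifold ContDiff Topology
open Set Function Metric
open Literature.Topology.FourManifolds.TorusKnotMilnor

namespace Literature.Topology.FourManifolds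

/-- Local notation: `𝔼 n` is the model Euclidean space `EuclideanSpace ℝ (Fin n)`. -/
local notation "𝔼 " n:arg => EuclideanSpace ℝ (Fin n)

namespace LefschetzBase

variable {g : ℕ}

/-! ## §13 The base page and the traces of the Milnor cover -/

/-- **The piece `pageU g = U ∩ page g 1`** of the base page (the two `y`-sheets over
`Re x^{2g+1} > −3/8`). [cite: Milnor1968, §9 Lemma 9.2] -/
def pageU (g : ℕ) : Set ↥(page g 1) := {q | q.1 ∈ coverU g}

/-- **The piece `pageV g = V ∩ page g 1`** of the base page (the `2g+1` sectors
`Re x^{2g+1} < −1/4`). [cite: Milnor1968, §9 Lemma 9.2] -/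
def pageV (g : ℕ) : Set ↥(page g 1) := {q | q.1 ∈ coverV g}

/-- `pageU` is open. [folklore] -/
theorem isOpen_pageU (g : ℕ) : IsOpen (pageU g) := (isOpen_coverU g).preimage continuous_subtype_val

/-- `pageV` is open. [folklore] -/
theorem isOpen_pageV (g : ℕ) : IsOpen (pageV g) := (isOpen_coverV g).preimage continuous_subtype_val

/-- On the base page `y² = x^{2g+1} + 3/2`. [folklore] -/
theorem cy_sq_of_mem_page (q : ↥(page g 1)) : cy q.1.1 ^ 2 = cx q.1.1 ^ (2 * g + 1) + 3 / 2 := by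
  have h : w g q.1.1 = 1 / 2 := q.2.2
  rw [w_eq'] at h
  linear_combination h

/-- On the base page `‖x‖^{2g+1} < 2^{2g+1}`. [folklore] -/
theorem norm_cx_pow_lt (q : ↥(page g 1)) : ‖cx q.1.1‖ ^ (2 * g + 1) < 2 ^ (2 * g + 1) := by
  have h : ‖cx q.1.1‖ ^ 2 < 4 := q.2.1
  have h2 : ‖cx q.1.1‖ < 2 := by nlinarith [norm_nonneg (cx q.1.1)]
  exact pow_lt_pow_left₀ h2 (norm_nonneg _) (Nat.succ_ne_zero _)

/-- **Staying in the base**: a point `(a', b')` with `b'² − a'^{2g+1} − 1 = 1/2` and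
`‖a'‖^{2g+1} < 2^{2g+1}` has `rho = 1/4` (`eta` vanishes on `‖a'‖² ≤ 4`). [folklore] -/
theorem mk_mem_base_of_page {a' b' : ℂ} (hw : b' ^ 2 - a' ^ (2 * g + 1) - 1 = 1 / 2)
    (ha : ‖a'‖ ^ (2 * g + 1) < 2 ^ (2 * g + 1)) : mk a' b' ∈ rho g ⁻¹' Iic (1 / 4 : ℝ) := by
  have ha2 : ‖a'‖ < 2 := lt_of_pow_lt_pow_left₀ _ (by norm_num) ha
  rw [mem_preimage, mem_Iic, rho_mk', hw, eta_of_le (by nlinarith [norm_nonneg a']),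
    show (1 / 2 : ℂ) = ((1 / 2 : ℝ) : ℂ) by push_cast; ring, Complex.norm_real, Real.norm_eq_abs,
    abs_of_pos (by norm_num)]
  norm_num

/-- **Staying in the page**: such a point lies in the base page. [folklore] -/
theorem mk_mem_page {a' b' : ℂ} (hw : b' ^ 2 - a' ^ (2 * g + 1) - 1 = 1 / 2)
    (ha : ‖a'‖ ^ (2 * g + 1) < 2 ^ (2 * g + 1)) :
    (⟨mk a' b', mk_mem_base_of_page hw ha⟩ : Base g) ∈ page g 1 := by
  have ha2 : ‖a'‖ < 2 := lt_of_pow_lt_pow_left₀ _ (by norm_num) ha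
  refine ⟨?_, ?_⟩
  · show ‖cx (mk a' b')‖ ^ 2 < 4
    rw [cx_mk]; nlinarith [norm_nonneg a']
  · show w g (mk a' b') = 1 / 2
    rw [w_eq', cx_mk, cy_mk, hw]

/-- A convex combination of two numbers `< B` is `< B`. [folklore] -/
theorem convex_comb_lt {s c d B : ℝ} (hs0 : 0 ≤ s) (hs1 : s ≤ 1) (hc : c < B) (hd : d < B) :
    (1 - s) * c + s * d < B := by
  nlinarith [mul_nonneg hs0 (sub_pos.2 hd).le, mul_nonneg (sub_nonneg.2 hs1) (sub_pos.2 hc).le,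
    mul_pos (sub_pos.2 hd) (sub_pos.2 hc)]

/-- `2 ≤ 2^{2g+1}`. [folklore] -/
theorem two_le_two_pow (g : ℕ) : (2 : ℝ) ≤ 2 ^ (2 * g + 1) := by
  calc (2 : ℝ) = 2 ^ 1 := (pow_one _).symm
    _ ≤ 2 ^ (2 * g + 1) := pow_le_pow_right₀ (by norm_num) (by omega)

/-! ## §14 The piece `pageU` retracts onto the two points `(0, ±√(3/2))` -/

/-- A point of `pageU`, as a point of `U`. [folklore] -/
abbrev pU (q : ↥(pageU g)) : ↥(coverU g) := ⟨q.1.1, q.2⟩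

/-- **The restriction `pageU g → U` of the inclusion of the page.** [folklore] -/
def resPU (g : ℕ) : C(↥(pageU g), ↥(coverU g)) :=
  ⟨fun q => pU q, (continuous_subtype_val.comp continuous_subtype_val).subtype_mk _⟩

/-- **The deformation of `pageU`**: `(x, y) ↦ (t x, angU · √((tx)^{2g+1} + 3/2))`.
[cite: Milnor1968, §9 Lemma 9.2] -/
def defPU (t : ℝ) (q : ↥(pageU g)) : 𝔼 4 :=
  mk ((t : ℂ) * cx q.1.1.1) (angU (pU q) * csqrt (((t : ℂ) * cx q.1.1.1) ^ (2 * g + 1) + 3 / 2))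

/-- Along the deformation the radicand has `Re > 9/8`. [folklore] -/
theorem re_radPU_gt {t : ℝ} (ht0 : 0 ≤ t) (ht1 : t ≤ 1) (q : ↥(pageU g)) :
    9 / 8 < (((t : ℂ) * cx q.1.1.1) ^ (2 * g + 1) + 3 / 2).re := by
  have h : -(3 / 8 : ℝ) < (((t : ℂ) * cx q.1.1.1) ^ (2 * g + 1)).re := re_tx_pow_gt ht0 ht1 (pU q)
  rw [Complex.add_re, show ((3 / 2 : ℂ)).re = 3 / 2 by norm_num]
  linarith

/-- Along the deformation `w = 1/2`. [folklore] -/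
theorem defPU_w (t : ℝ) (q : ↥(pageU g)) :
    (angU (pU q) * csqrt (((t : ℂ) * cx q.1.1.1) ^ (2 * g + 1) + 3 / 2)) ^ 2 -
      ((t : ℂ) * cx q.1.1.1) ^ (2 * g + 1) - 1 = 1 / 2 := by
  rw [mul_pow, angU_pow, one_mul, csqrt_sq]; ring

/-- Along the deformation `‖x‖^{2g+1} < 2^{2g+1}`. [folklore] -/
theorem defPU_xpow_lt {t : ℝ} (ht0 : 0 ≤ t) (ht1 : t ≤ 1) (q : ↥(pageU g)) :
    ‖(t : ℂ) * cx q.1.1.1‖ ^ (2 * g + 1) < 2 ^ (2 * g + 1) := by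
  rw [norm_mul, Complex.norm_real, Real.norm_eq_abs, abs_of_nonneg ht0, mul_pow]
  exact lt_of_le_of_lt (mul_le_of_le_one_left (pow_nonneg (norm_nonneg _) _) (pow_le_one₀ ht0 ht1))
    (norm_cx_pow_lt q.1)

/-- The deformation stays in `pageU` (in the base and in the page by §13). [folklore] -/
theorem defPU_mem_pageU {t : ℝ} (ht0 : 0 ≤ t) (ht1 : t ≤ 1) (q : ↥(pageU g)) :
    (⟨⟨defPU t q, mk_mem_base_of_page (defPU_w t q) (defPU_xpow_lt ht0 ht1 q)⟩,
      mk_mem_page (defPU_w t q) (defPU_xpow_lt ht0 ht1 q)⟩ : ↥(page g 1)) ∈ pageU g := by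
  show -(3 / 8 : ℝ) < (cx (defPU t q) ^ (2 * g + 1)).re
  rw [defPU, cx_mk]
  exact re_tx_pow_gt ht0 ht1 (pU q)

/-- The deformation as a map `[0,1] × pageU → pageU`. [folklore] -/
def defPUMap (z : unitInterval × ↥(pageU g)) : ↥(pageU g) := ⟨_, defPU_mem_pageU z.1.2.1 z.1.2.2 z.2⟩

/-- The deformation is continuous. [folklore] -/
theorem continuous_defPUMap : Continuous (defPUMap (g := g)) := by
  refine Continuous.subtype_mk (Continuous.subtype_mk (Continuous.subtype_mk ?_ _) _) _
  have hs : Continuous fun z : unitInterval × ↥(pageU g) => ((z.1 : ℝ) : ℂ) :=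
    Complex.continuous_ofReal.comp (continuous_subtype_val.comp continuous_fst)
  have hx : Continuous fun z : unitInterval × ↥(pageU g) => cx z.2.1.1.1 :=
    contDiff_cx.continuous.comp (continuous_subtype_val.comp (continuous_subtype_val.comp
      (continuous_subtype_val.comp continuous_snd)))
  have hrad : Continuous fun z : unitInterval × ↥(pageU g) =>
      (((z.1 : ℝ) : ℂ) * cx z.2.1.1.1) ^ (2 * g + 1) + 3 / 2 := ((hs.mul hx).pow _).add continuous_const
  have hroot : Continuous fun z : unitInterval × ↥(pageU g) =>
      csqrt ((((z.1 : ℝ) : ℂ) * cx z.2.1.1.1) ^ (2 * g + 1) + 3 / 2) :=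
    continuousOn_csqrt.comp_continuous hrad fun z => lt_trans (by norm_num) (re_radPU_gt z.1.2.1 z.1.2.2 z.2)
  have hpU : Continuous fun z : unitInterval × ↥(pageU g) => pU z.2 :=
    ((continuous_subtype_val.comp continuous_subtype_val).subtype_mk _).comp continuous_snd
  have hang : Continuous fun z : unitInterval × ↥(pageU g) => angU (pU z.2) := continuous_angU.comp hpU
  exact continuous_mk.comp ((hs.mul hx).prodMk (hang.mul hroot))

/-- At `t = 1` the deformation is the identity. [folklore] -/
theorem defPU_one (q : ↥(pageU g)) : defPU 1 q = q.1.1.1 := by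
  have hy : angU (pU q) * csqrt (cy q.1.1.1 ^ 2) = cy q.1.1.1 := (cy_eq_angU_mul (pU q)).symm
  rw [defPU, Complex.ofReal_one, one_mul, ← cy_sq_of_mem_page q.1, hy, mk_cx_cy]

/-- The base point `(0, μ₂^k √(3/2))` of `pageU` lies in the base. [folklore] -/
theorem basePtPU_w (k : ℕ) : (rootU 2 ^ k * csqrt (3 / 2)) ^ 2 - (0 : ℂ) ^ (2 * g + 1) - 1 = 1 / 2 := by
  rw [mul_pow, rootU_pow_pow two_ne_zero, one_mul, csqrt_sq, zero_pow (Nat.succ_ne_zero _)]; norm_num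

/-- `‖0‖^{2g+1} < 2^{2g+1}`. [folklore] -/
theorem norm_zero_pow_lt (g : ℕ) : ‖(0 : ℂ)‖ ^ (2 * g + 1) < 2 ^ (2 * g + 1) := by
  rw [norm_zero, zero_pow (Nat.succ_ne_zero _)]; positivity

/-- The base points of `pageU` lie in `pageU` (`x = 0`). [folklore] -/
theorem basePtPU_mem_pageU (k : ℕ) :
    (⟨⟨mk 0 (rootU 2 ^ k * csqrt (3 / 2)), mk_mem_base_of_page (basePtPU_w k) (norm_zero_pow_lt g)⟩,
      mk_mem_page (basePtPU_w k) (norm_zero_pow_lt g)⟩ : ↥(page g 1)) ∈ pageU g := by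
  show -(3 / 8 : ℝ) < (cx (mk 0 (rootU 2 ^ k * csqrt (3 / 2))) ^ (2 * g + 1)).re
  rw [cx_mk, zero_pow (Nat.succ_ne_zero _), Complex.zero_re]; norm_num

/-- **The section `Fin 2 → pageU`**, `k ↦ (0, μ₂^k √(3/2))`. [folklore] -/
def secPU (g : ℕ) : C(Fin 2, ↥(pageU g)) :=
  ⟨fun k => ⟨_, basePtPU_mem_pageU (g := g) k⟩, continuous_of_discreteTopology⟩

/-- The sheet sign of the base point `k` is `μ₂^k`. [folklore] -/
theorem angU_secPU (k : Fin 2) : angU (pU (secPU g k)) = rootU 2 ^ (k : ℕ) := by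
  rw [angU]
  show cy (mk 0 _) / csqrt (cy (mk 0 _) ^ 2) = _
  rw [cy_mk, mul_pow, rootU_pow_pow two_ne_zero, one_mul, csqrt_sq,
    mul_div_cancel_right₀ _ (csqrt_ne_zero (by norm_num))]

/-- `idx ∘ res ∘ sec = id` on `pageU`. [folklore] -/
theorem idxU_secPU (k : Fin 2) : idxU (resPU g (secPU g k)) = k := by
  show rootIdx two_ne_zero (angU (pU (secPU g k))) = k
  rw [angU_secPU, rootIdx_rootU_pow]

/-- At `t = 0` the deformation is the base point `sec (idx q)`. [folklore] -/
theorem defPU_zero (q : ↥(pageU g)) : defPU 0 q = (secPU g (idxU (resPU g q))).1.1.1 := by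
  rw [defPU, Complex.ofReal_zero, zero_mul, zero_pow (Nat.succ_ne_zero _), zero_add]
  show mk 0 (angU (pU q) * csqrt (3 / 2)) =
    mk 0 (rootU 2 ^ (rootIdx two_ne_zero (angU (pU q)) : ℕ) * csqrt (3 / 2))
  rw [rootU_pow_rootIdx two_ne_zero (angU_pow (pU q))]

/-- **The homotopy `id_{pageU} ≃ sec ∘ idx ∘ res`.** [cite: Milnor1968, §9 Lemma 9.2] -/
def homotopyPU (g : ℕ) : ContinuousMap.Homotopy (ContinuousMap.id ↥(pageU g))
    ((secPU g).comp ((homotopyEquivU g).toFun.comp (resPU g))) where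
  toFun z := defPUMap (unitInterval.symm z.1, z.2)
  continuous_toFun := continuous_defPUMap.comp
    ((unitInterval.continuous_symm.comp continuous_fst).prodMk continuous_snd)
  map_zero_left q := by
    apply Subtype.ext; apply Subtype.ext; apply Subtype.ext
    show defPU (unitInterval.symm 0 : ℝ) q = q.1.1.1
    rw [unitInterval.symm_zero, Set.Icc.coe_one, defPU_one]
  map_one_left q := by
    apply Subtype.ext; apply Subtype.ext; apply Subtype.ext
    show defPU (unitInterval.symm 1 : ℝ) q = (secPU g (idxU (resPU g q))).1.1.1
    rw [unitInterval.symm_one, Set.Icc.coe_zero, defPU_zero]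

/-! ## §15 The piece `pageV` retracts onto the `2g+1` branch points of the page -/

/-- A point of `pageV`, as a point of `V`. [folklore] -/
abbrev pV (q : ↥(pageV g)) : ↥(coverV g) := ⟨q.1.1, q.2⟩

/-- **The restriction `pageV g → V` of the inclusion of the page.** [folklore] -/
def resPV (g : ℕ) : C(↥(pageV g), ↥(coverV g)) :=
  ⟨fun q => pV q, (continuous_subtype_val.comp continuous_subtype_val).subtype_mk _⟩

/-- The radicand `3/2 − t²(x^{2g+1} + 3/2)` of the deformation of `pageV`. [folklore] -/
def radPV (t : ℝ) (q : ↥(pageV g)) : ℂ := 3 / 2 - (t : ℂ) ^ 2 * (cx q.1.1.1 ^ (2 * g + 1) + 3 / 2)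

/-- `Re (3/2 − t²(x^{2g+1} + 3/2)) > 1/4` for `t ∈ [0, 1]`. [folklore] -/
theorem re_radPV_gt {t : ℝ} (ht0 : 0 ≤ t) (ht1 : t ≤ 1) (q : ↥(pageV g)) : 1 / 4 < (radPV t q).re := by
  have hV : (cx q.1.1.1 ^ (2 * g + 1)).re < -(1 / 4 : ℝ) := q.2
  have ht : 0 ≤ t ^ 2 := sq_nonneg t
  have ht' : t ^ 2 ≤ 1 := pow_le_one₀ ht0 ht1
  rw [radPV, ← Complex.ofReal_pow, Complex.sub_re, Complex.re_ofReal_mul, Complex.add_re,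
    show ((3 / 2 : ℂ)).re = 3 / 2 by norm_num]
  rcases le_or_gt 0 ((cx q.1.1.1 ^ (2 * g + 1)).re + 3 / 2) with h | h <;> nlinarith

/-- `‖3/2 − t²(x^{2g+1} + 3/2)‖ < 2^{2g+1}` on the page. [folklore] -/
theorem norm_radPV_lt {t : ℝ} (ht0 : 0 ≤ t) (ht1 : t ≤ 1) (q : ↥(pageV g)) :
    ‖radPV t q‖ < 2 ^ (2 * g + 1) := by
  have ht : 0 ≤ t ^ 2 := sq_nonneg t
  have ht' : t ^ 2 ≤ 1 := pow_le_one₀ ht0 ht1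
  have h32 : (3 / 2 : ℝ) < 2 ^ (2 * g + 1) := by linarith [two_le_two_pow g]
  calc ‖radPV t q‖ = ‖((((1 - t ^ 2) * (3 / 2) : ℝ)) : ℂ) + (-(((t ^ 2 : ℝ)) : ℂ) * cx q.1.1.1 ^ (2 * g + 1))‖ := by
        rw [radPV]; congr 1; push_cast; ring
    _ ≤ (1 - t ^ 2) * (3 / 2) + t ^ 2 * ‖cx q.1.1.1‖ ^ (2 * g + 1) := by
        refine (norm_add_le _ _).trans ?_
        rw [Complex.norm_real, Real.norm_eq_abs, abs_of_nonneg (by nlinarith), norm_mul, norm_neg,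
          Complex.norm_real, Real.norm_eq_abs, abs_of_nonneg ht, norm_pow]
    _ < 2 ^ (2 * g + 1) := convex_comb_lt ht ht' h32 (norm_cx_pow_lt q.1)

/-- **The deformation of `pageV`**: `(x, y) ↦ (angV · ν (3/2 − t²(x^{2g+1} + 3/2))^{1/(2g+1)}, t y)`.
[cite: Milnor1968, §9 Lemma 9.2] -/
def defPV (t : ℝ) (q : ↥(pageV g)) : 𝔼 4 :=
  mk (angV (pV q) * (halfRoot (2 * g + 1) * prRoot (2 * g + 1) (radPV t q))) ((t : ℂ) * cy q.1.1.1)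

/-- Along the deformation `x^{2g+1} = −(3/2 − t²(x^{2g+1} + 3/2))`. [folklore] -/
theorem defPV_xPow (t : ℝ) (q : ↥(pageV g)) :
    (angV (pV q) * (halfRoot (2 * g + 1) * prRoot (2 * g + 1) (radPV t q))) ^ (2 * g + 1) = -radPV t q := by
  rw [mul_pow, angV_pow, one_mul, mul_pow, halfRoot_pow (odd_ne_zero g), prRoot_pow (odd_ne_zero g)]; ring

/-- Along the deformation `w = 1/2`. [folklore] -/
theorem defPV_w (t : ℝ) (q : ↥(pageV g)) :
    ((t : ℂ) * cy q.1.1.1) ^ 2 -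
      (angV (pV q) * (halfRoot (2 * g + 1) * prRoot (2 * g + 1) (radPV t q))) ^ (2 * g + 1) - 1 = 1 / 2 := by
  rw [defPV_xPow, radPV, mul_pow, cy_sq_of_mem_page q.1]; ring

/-- Along the deformation `‖x‖^{2g+1} < 2^{2g+1}`. [folklore] -/
theorem defPV_xpow_lt {t : ℝ} (ht0 : 0 ≤ t) (ht1 : t ≤ 1) (q : ↥(pageV g)) :
    ‖angV (pV q) * (halfRoot (2 * g + 1) * prRoot (2 * g + 1) (radPV t q))‖ ^ (2 * g + 1) <
      2 ^ (2 * g + 1) := by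
  rw [← norm_pow, defPV_xPow, norm_neg]; exact norm_radPV_lt ht0 ht1 q

/-- The deformation stays in `pageV` (in the base and in the page by §13). [folklore] -/
theorem defPV_mem_pageV {t : ℝ} (ht0 : 0 ≤ t) (ht1 : t ≤ 1) (q : ↥(pageV g)) :
    (⟨⟨defPV t q, mk_mem_base_of_page (defPV_w t q) (defPV_xpow_lt ht0 ht1 q)⟩,
      mk_mem_page (defPV_w t q) (defPV_xpow_lt ht0 ht1 q)⟩ : ↥(page g 1)) ∈ pageV g := by
  show (cx (defPV t q) ^ (2 * g + 1)).re < -(1 / 4 : ℝ)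
  rw [defPV, cx_mk, defPV_xPow, Complex.neg_re]
  linarith [re_radPV_gt ht0 ht1 q]

/-- The deformation as a map `[0,1] × pageV → pageV`. [folklore] -/
def defPVMap (z : unitInterval × ↥(pageV g)) : ↥(pageV g) := ⟨_, defPV_mem_pageV z.1.2.1 z.1.2.2 z.2⟩

/-- The deformation is continuous. [folklore] -/
theorem continuous_defPVMap : Continuous (defPVMap (g := g)) := by
  refine Continuous.subtype_mk (Continuous.subtype_mk (Continuous.subtype_mk ?_ _) _) _
  have hs : Continuous fun z : unitInterval × ↥(pageV g) => ((z.1 : ℝ) : ℂ) :=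
    Complex.continuous_ofReal.comp (continuous_subtype_val.comp continuous_fst)
  have hq : Continuous fun z : unitInterval × ↥(pageV g) => z.2.1.1.1 :=
    continuous_subtype_val.comp (continuous_subtype_val.comp (continuous_subtype_val.comp continuous_snd))
  have hy : Continuous fun z : unitInterval × ↥(pageV g) => cy z.2.1.1.1 := contDiff_cy.continuous.comp hq
  have hP : Continuous fun z : unitInterval × ↥(pageV g) => cx z.2.1.1.1 ^ (2 * g + 1) :=
    (contDiff_cx.continuous.comp hq).pow _
  have hrad : Continuous fun z : unitInterval × ↥(pageV g) => radPV (z.1 : ℝ) z.2 :=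
    continuous_const.sub ((hs.pow 2).mul (hP.add continuous_const))
  have hroot : Continuous fun z : unitInterval × ↥(pageV g) => prRoot (2 * g + 1) (radPV (z.1 : ℝ) z.2) :=
    (continuousOn_prRoot _).comp_continuous hrad fun z =>
      lt_trans (by norm_num) (re_radPV_gt z.1.2.1 z.1.2.2 z.2)
  have hpV : Continuous fun z : unitInterval × ↥(pageV g) => pV z.2 :=
    ((continuous_subtype_val.comp continuous_subtype_val).subtype_mk _).comp continuous_snd
  have hang : Continuous fun z : unitInterval × ↥(pageV g) => angV (pV z.2) := continuous_angV.comp hpV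
  exact continuous_mk.comp ((hang.mul (continuous_const.mul hroot)).prodMk (hs.mul hy))

/-- At `t = 1` the deformation is the identity. [folklore] -/
theorem defPV_one (q : ↥(pageV g)) : defPV 1 q = q.1.1.1 := by
  have h : radPV 1 q = -cx q.1.1.1 ^ (2 * g + 1) := by
    rw [radPV, Complex.ofReal_one, one_pow, one_mul]; ring
  have hx : angV (pV q) * (halfRoot (2 * g + 1) * prRoot (2 * g + 1) (-cx q.1.1.1 ^ (2 * g + 1))) =
      cx q.1.1.1 := (cx_eq_angV_mul (pV q)).symm
  rw [defPV, h, hx, Complex.ofReal_one, one_mul, mk_cx_cy]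

/-- The `x`-coordinate `ν μ^k (3/2)^{1/(2g+1)}` of the `k`-th branch point of the page has
`x^{2g+1} = −3/2`. [folklore] -/
theorem basePtPV_xpow (g k : ℕ) :
    (halfRoot (2 * g + 1) * rootU (2 * g + 1) ^ k * prRoot (2 * g + 1) (3 / 2)) ^ (2 * g + 1) = -(3 / 2) := by
  rw [mul_pow, basePtV_pow, prRoot_pow (odd_ne_zero g)]; ring

/-- The branch point `(ν μ^k (3/2)^{1/(2g+1)}, 0)` of the page: `w = 1/2`. [folklore] -/
theorem basePtPV_w (g k : ℕ) :
    (0 : ℂ) ^ 2 - (halfRoot (2 * g + 1) * rootU (2 * g + 1) ^ k * prRoot (2 * g + 1) (3 / 2)) ^ (2 * g + 1) - 1 =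
      1 / 2 := by
  rw [basePtPV_xpow]; norm_num

/-- The branch points of the page have `‖x‖^{2g+1} = 3/2 < 2^{2g+1}`. [folklore] -/
theorem basePtPV_norm_lt (g k : ℕ) :
    ‖halfRoot (2 * g + 1) * rootU (2 * g + 1) ^ k * prRoot (2 * g + 1) (3 / 2)‖ ^ (2 * g + 1) <
      2 ^ (2 * g + 1) := by
  rw [← norm_pow, basePtPV_xpow, norm_neg]
  have h32 : ‖((3 / 2 : ℂ))‖ = 3 / 2 := by
    rw [show (3 / 2 : ℂ) = ((3 / 2 : ℝ) : ℂ) by push_cast; ring, Complex.norm_real, Real.norm_eq_abs,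
      abs_of_pos (by norm_num)]
  rw [h32]; linarith [two_le_two_pow g]

/-- The branch points of the page lie in `pageV` (`Re x^{2g+1} = −3/2`). [folklore] -/
theorem basePtPV_mem_pageV (k : ℕ) :
    (⟨⟨mk (halfRoot (2 * g + 1) * rootU (2 * g + 1) ^ k * prRoot (2 * g + 1) (3 / 2)) 0,
      mk_mem_base_of_page (basePtPV_w g k) (basePtPV_norm_lt g k)⟩,
      mk_mem_page (basePtPV_w g k) (basePtPV_norm_lt g k)⟩ : ↥(page g 1)) ∈ pageV g := by
  show (cx (mk _ 0) ^ (2 * g + 1)).re < -(1 / 4 : ℝ)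
  rw [cx_mk, basePtPV_xpow]; norm_num

/-- **The section `Fin (2g+1) → pageV`**, `k ↦ (ν μ^k (3/2)^{1/(2g+1)}, 0)`. [folklore] -/
def secPV (g : ℕ) : C(Fin (2 * g + 1), ↥(pageV g)) :=
  ⟨fun k => ⟨_, basePtPV_mem_pageV (g := g) k⟩, continuous_of_discreteTopology⟩

/-- The sector root of the `k`-th branch point of the page is `μ^k`. [folklore] -/
theorem angV_secPV (k : Fin (2 * g + 1)) : angV (pV (secPV g k)) = rootU (2 * g + 1) ^ (k : ℕ) := by
  rw [angV]
  show cx (mk _ 0) / (halfRoot (2 * g + 1) * prRoot (2 * g + 1) (-(cx (mk _ 0) ^ (2 * g + 1)))) = _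
  rw [cx_mk, basePtPV_xpow, neg_neg, mul_assoc, mul_comm (rootU _ ^ _), ← mul_assoc,
    mul_div_cancel_left₀ _ (mul_ne_zero (halfRoot_ne_zero _) (prRoot_ne_zero (odd_ne_zero g) (by norm_num)))]

/-- `idx ∘ res ∘ sec = id` on `pageV`. [folklore] -/
theorem idxV_secPV (k : Fin (2 * g + 1)) : idxV (resPV g (secPV g k)) = k := by
  show rootIdx (odd_ne_zero g) (angV (pV (secPV g k))) = k
  rw [angV_secPV, rootIdx_rootU_pow]

/-- At `t = 0` the deformation is the branch point `sec (idx q)`. [folklore] -/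
theorem defPV_zero (q : ↥(pageV g)) : defPV 0 q = (secPV g (idxV (resPV g q))).1.1.1 := by
  have h : radPV 0 q = 3 / 2 := by rw [radPV, Complex.ofReal_zero, zero_pow two_ne_zero, zero_mul, sub_zero]
  rw [defPV, h, Complex.ofReal_zero, zero_mul]
  show mk (angV (pV q) * (halfRoot (2 * g + 1) * prRoot (2 * g + 1) (3 / 2))) 0 =
    mk (halfRoot (2 * g + 1) * rootU (2 * g + 1) ^ (rootIdx (odd_ne_zero g) (angV (pV q)) : ℕ) *
      prRoot (2 * g + 1) (3 / 2)) 0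
  rw [rootU_pow_rootIdx (odd_ne_zero g) (angV_pow (pV q))]
  congr 1; ring

/-- **The homotopy `id_{pageV} ≃ sec ∘ idx ∘ res`.** [cite: Milnor1968, §9 Lemma 9.2] -/
def homotopyPV (g : ℕ) : ContinuousMap.Homotopy (ContinuousMap.id ↥(pageV g))
    ((secPV g).comp ((homotopyEquivV g).toFun.comp (resPV g))) where
  toFun z := defPVMap (unitInterval.symm z.1, z.2)
  continuous_toFun := continuous_defPVMap.comp
    ((unitInterval.continuous_symm.comp continuous_fst).prodMk continuous_snd)
  map_zero_left q := by
    apply Subtype.ext; apply Subtype.ext; apply Subtype.ext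
    show defPV (unitInterval.symm 0 : ℝ) q = q.1.1.1
    rw [unitInterval.symm_zero, Set.Icc.coe_one, defPV_one]
  map_one_left q := by
    apply Subtype.ext; apply Subtype.ext; apply Subtype.ext
    show defPV (unitInterval.symm 1 : ℝ) q = (secPV g (idxV (resPV g q))).1.1.1
    rw [unitInterval.symm_one, Set.Icc.coe_zero, defPV_zero]

end LefschetzBase

end Literature.Topology.FourManifolds
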